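import Summits.BirchSwinnertonDyer.BirchSwinnertonDyer.Theorems.EisensteinDepletionAtTwoStarEtaleLiftSecondPointPrelims
import HarnessLib

/-!
# Stub S4 `stub_etaleLiftSecondPoint` of line `star` v18 (crux E1M, stmt-BirchSwinnertonDyer-20341): the ÉTALE twin of the node law —
# an étale rational 2-torsion point of the optimal curve that lifts through `Γ₁(N)` (even Manin constant) forces a second étale point
# (lead star-p1 GEN 21, 2026-08-29)

The (F)-side middle step of the parity split, modelled on GEN 18's `SigmaNode.sigmaNode_of_cuspImageNonsingular` (the node law (N256) for a
FORMAL point).  Data: the `X₀(N)`-lattice-optimal minimal `W₀` (`Λ₀ = q·Λ_f`, `q` an EVEN integer), good ordinary at `2`, an ÉTALE rational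
2-torsion abscissa `x` (so `x ∈ ℤ`) with half-period `z₀ = λ/2`, `e₀ = ℘(z₀) = x + b₂/12`, and LIFT: `q{∞,γ∞}_f ∈ ℤλ + 2Λ₀` on `Γ₁(N)`.
* (0) `x = ξ ∈ ℤ`, `β = b₄ + ξb₂ + 6ξ² ∈ ℤ ∖ {0}`, `D = α² − 32β ∈ ℤ` (`α = b₂ + 12ξ`), `4Δ = β²D`, `Δ` odd.
* (1) some `μ = q{∞,γ∞}_f ∈ Λ₀` lies outside `ℤλ + 2Λ₀` (`Λ₀ = qΛ_f` is not inside a half-lattice); LIFT on all of `Λ₁(f)`.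
* (2) the globally minimal 2-isogenous partner `W′` (`ManinLocalTwoThree.exists_isIsogenous_dvd_two_velu_two`): the 2-adic count
  `3·ord₂(β/2) + 12·ord₂ k = 0` with `β ∈ ℤ` forces `k = ±1` (and `ord₂ β = 1`), so by Vélu on the analytic side the Néron lattice of `W′` is
  `Λ″ = Λ₀ + ℤz₀` itself (étale case; the formal case had `k = ±2`, `2Λ₀ + ℤλ`).  The datum for (F) is `c = q/2 ∈ ℤ` — THIS is where the
  evenness of `q` is used: `(q/2)Λ₁(f) ⊆ ½(ℤλ + 2Λ₀) = Λ″`, and the cusp image `(q/2){∞,γ∞}_f = μ/2 ∉ Λ″`.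
* (3) (F) gives the rational 2-torsion point `T̄ = (x′, y′)` of `W′` with `℘_{Λ″}(μ/2) = −2e₀`, `x′ = −2e₀ − b₂(W′)/12`, `Φ_x(T̄) = −D/16`,
  non-singular at every prime.
* (4) At every odd prime `p`: `ord_p Φ_x(T̄) = 0` (`Φ_y = 0`, `4x′ ∈ ℤ`), so `D` has no odd prime factor; `4Δ = β²D` with `Δ` odd and
  `ord₂ β = 1` makes `D` odd, hence `D = ±1`, and `D = α² − 32β ≡ α² (mod 4)` excludes `−1`: `D = 1`.
* (5) `α² − 1 = 32β`: `α` is odd, one of `α ∓ 1` is divisible by `16`, and `r = (−α ± 1)/8 ∈ 2ℤ ∖ {0}` is a root of `4X² + αX + 2β`;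
  since `cubic(x + X) = cubic(x) + X(4X² + αX + 2β)`, `x₁ = x + r` is a second rational 2-torsion abscissa, an integer, hence étale.
CONDITIONAL only on (F) (a print, hypothesis); no `sorry`, no definition; nothing here reads `r_an`; E1M / BSD are NOT proved by this file.
-/

set_option linter.dupNamespace false
set_option autoImplicit false

noncomputable section

open scoped Classical MatrixGroups PeriodPair
open CongruenceSubgroup Polynomial
open WeierstrassCurve Literature.NumberTheory.EllipticCurves Literature.NumberTheory.EllipticCurves.Greenberg1999
open Literature.NumberTheory.EllipticCurves.ModularForms

namespace Summit.BirchSwinnertonDyer.BirchSwinnertonDyer.Theorems.DepletionAtTwo.SigmaNode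

/-! ### The stub -/

set_option maxHeartbeats 1000000 in
/-- **Stub S4 `stub_etaleLiftSecondPoint` of line `star` v18 — PROVED** (the registered signature verbatim; see the file docstring for the route).
CONDITIONAL only on (F) (hypothesis). [cite: ConradEdixhovenStein2003, §6.1.2 proof of Lemma 6.1.6 (p. 381)] [cite: SilvermanAEC2009, III.4 Example 4.5 and VII.2] -/
theorem stub_etaleLiftSecondPoint :
    gamma1Parametrization_cuspImage_nonsingularReduction →
    ∀ (W₀ : WeierstrassCurve ℚ) [W₀.IsElliptic] [W₀.IsGloballyMinimal] ⦃N : ℕ⦄ [NeZero N]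
      (f : CuspForm (CongruenceSubgroup.Gamma0 N) 2), IsNewformOf W₀ f → ¬ 2 ∣ N → IsOrdinaryAt W₀ 2 →
      ∀ (L₀ : PeriodPair), IsNeronLatticeOf (W₀.baseChange ℂ) L₀ → ∀ (q : ℤ), q ≠ 0 → Even q →
      (∀ z ∈ periodLattice f, (q : ℂ) * z ∈ L₀.lattice) → (∀ z ∈ L₀.lattice, ∃ w ∈ periodLattice f, z = (q : ℂ) * w) →
      ∀ (x₀ : ℚ), HasRationalTwoTorsionX W₀ x₀ → ¬ TwoTorsionRamifiedAtTwo x₀ →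
      ∀ (lam : ℂ), lam ∈ L₀.lattice → lam / 2 ∉ L₀.lattice →
        L₀.weierstrassP (lam / 2) - ((W₀.b₂ : ℚ) : ℂ) / 12 = ((x₀ : ℚ) : ℂ) →
      (∀ (γ : SL(2, ℤ)) (hγ : γ ∈ CongruenceSubgroup.Gamma0 N), γ ∈ CongruenceSubgroup.Gamma1 N →
        ∃ k : ℤ, ∃ w ∈ L₀.lattice, ((q : ℚ) : ℂ) * cuspSymbol f ⟨γ, hγ⟩ = (k : ℂ) * lam + 2 * w) →
      ∃ x₁ : ℚ, x₁ ≠ x₀ ∧ HasRationalTwoTorsionX W₀ x₁ ∧ ¬ TwoTorsionRamifiedAtTwo x₁ := by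
  intro hF W₀ _ _ N _ f hW₀ _ hord L₀ hL₀ q hq0 hev hin hout x hx hnr lam hlam hlam2 hwp hpar
  simp only [Rat.cast_intCast] at hpar
  -- ### (0) bookkeeping on `W₀`: `x = ξ ∈ ℤ`, `b₂, b₄ ∈ ℤ`, `Δ` odd, `4Δ = β²D`
  have hgood : W₀.HasGoodReductionAtPrime 2 := hord.1
  obtain ⟨ξ, hξ⟩ := exists_int_eq_of_etale W₀ hx hnr
  set M : WeierstrassCurve ℤ := WeierstrassCurve.integralModelInt W₀ with hM
  have hb₂ : W₀.b₂ = (M.b₂ : ℚ) := by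
    conv_lhs => rw [← WeierstrassCurve.map_integralModelInt W₀]
    rw [WeierstrassCurve.map_b₂, eq_intCast]
  have hb₄ : W₀.b₄ = (M.b₄ : ℚ) := by
    conv_lhs => rw [← WeierstrassCurve.map_integralModelInt W₀]
    rw [WeierstrassCurve.map_b₄, eq_intCast]
  have hΔodd : Odd M.Δ := odd_Δ_integralModelInt_of_good_two W₀ hgood
  have hΔcast : (M.Δ : ℚ) = W₀.Δ := WeierstrassCurve.cast_minimalDiscriminantInt W₀
  set αz : ℤ := M.b₂ + 12 * ξ with hαz
  set βz : ℤ := M.b₄ + ξ * M.b₂ + 6 * ξ ^ 2 with hβz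
  set Dz : ℤ := αz ^ 2 - 32 * βz with hDz
  set D : ℚ := (W₀.b₂ + 12 * x) ^ 2 - 32 * (W₀.b₄ + x * W₀.b₂ + 6 * x ^ 2) with hD
  have hαcast : W₀.b₂ + 12 * x = (αz : ℚ) := by rw [hαz, hb₂, ← hξ]; push_cast; ring
  have hβcast : W₀.b₄ + x * W₀.b₂ + 6 * x ^ 2 = (βz : ℚ) := by rw [hβz, hb₂, hb₄, ← hξ]; push_cast; ring
  have hDcast : D = (Dz : ℚ) := by rw [hD, hDz, hαcast, hβcast]; push_cast; ring
  have h4Δ : 4 * W₀.Δ = (W₀.b₄ + x * W₀.b₂ + 6 * x ^ 2) ^ 2 * D := four_mul_Δ_eq W₀ hx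
  have hrel : βz ^ 2 * Dz = 4 * M.Δ := by
    have h : ((βz ^ 2 * Dz : ℤ) : ℚ) = ((4 * M.Δ : ℤ) : ℚ) := by
      push_cast; rw [hΔcast, ← hDcast, ← hβcast]; linear_combination -h4Δ
    exact_mod_cast h
  have hβ0 : βz ≠ 0 := by
    intro h0
    have : (4 : ℤ) * M.Δ = 0 := by rw [← hrel, h0]; ring
    rcases hΔodd with ⟨m, hm⟩
    omega
  have hβz0 : (βz : ℚ) ≠ 0 := by exact_mod_cast hβ0
  -- ### (1) a cusp symbol `μ = q{∞,γ∞}_f ∈ Λ₀` outside `ℤλ + 2Λ₀`; LIFT on all of `Λ₁(f)`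
  obtain ⟨γ, hγ, hμnot⟩ : ∃ (γ : SL(2, ℤ)) (hγ : γ ∈ Gamma0 N),
      ¬ ∃ k : ℤ, ∃ w ∈ L₀.lattice, (q : ℂ) * cuspSymbol f ⟨γ, hγ⟩ = (k : ℂ) * lam + 2 * w := by
    by_contra hall
    push Not at hall
    have hgen : ∀ w ∈ periodLattice f, ∃ k : ℤ, ∃ w' ∈ L₀.lattice, (q : ℂ) * w = (k : ℂ) * lam + 2 * w' := by
      intro w hw
      induction hw using AddSubgroup.closure_induction with
      | mem z hz =>
        obtain ⟨γ', rfl⟩ := hz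
        exact hall γ'.1 γ'.2
      | zero => rw [mul_zero]; exact ParityGroup.zero_mem_half L₀ lam
      | add u v hu hv ihu ihv =>
        rw [mul_add]
        exact (KummerStubs.halfLattice_add_iff L₀ hlam hlam2 (hin u hu) (hin v hv)).mpr (iff_of_true ihu ihv)
      | neg u hu ih => rw [mul_neg]; exact ParityGroup.neg_mem_half ih
    obtain ⟨z, hz, hnot⟩ := ParityGroup.exists_mem_lattice_not_half L₀ hlam hlam2
    obtain ⟨w, hw, rfl⟩ := hout z hz
    exact hnot (hgen w hw)
  set μ : ℂ := (q : ℂ) * cuspSymbol f ⟨γ, hγ⟩ with hμdef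
  have hμL₀ : μ ∈ L₀.lattice := hin _ (cuspSymbol_mem_periodLattice f ⟨γ, hγ⟩)
  have hμ2 : μ / 2 ∉ L₀.lattice := by
    intro h; apply hμnot
    exact ⟨0, μ / 2, h, by push_cast; ring⟩
  have hμz : μ / 2 - lam / 2 ∉ L₀.lattice := by
    intro h; apply hμnot
    exact ⟨1, μ / 2 - lam / 2, h, by push_cast; ring⟩
  have hparΛ₁ : ∀ w ∈ periodLatticeGamma1 f, ∃ k : ℤ, ∃ w' ∈ L₀.lattice, (q : ℂ) * w = (k : ℂ) * lam + 2 * w' := by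
    intro w hw
    induction hw using AddSubgroup.closure_induction with
    | mem z hz =>
      obtain ⟨γ', rfl⟩ := hz
      exact hpar γ'.1 (Gamma1_in_Gamma0 N γ'.2) γ'.2
    | zero => rw [mul_zero]; exact ParityGroup.zero_mem_half L₀ lam
    | add u v hu hv ihu ihv =>
      rw [mul_add]
      exact (KummerStubs.halfLattice_add_iff L₀ hlam hlam2 (hin u (periodLatticeGamma1_le_periodLattice f hu))
        (hin v (periodLatticeGamma1_le_periodLattice f hv))).mpr (iff_of_true ihu ihv)
    | neg u hu ih => rw [mul_neg]; exact ParityGroup.neg_mem_half ih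
  -- ### (2) the 2-isogenous partner `W′` of `W₀` by `P`, globally minimal; `k = ±1`; its Néron lattice is `Λ₀ + ℤz₀`
  set q' : ℚ := x + W₀.b₂ / 12 with hq'
  have hq'Ψ : W₀.Ψ₂Sq.eval (q' - W₀.b₂ / 12) = 0 := by
    have e : q' - W₀.b₂ / 12 = x := by rw [hq']; ring
    obtain ⟨y, hEq, h2y⟩ := hx
    rw [e]
    simp only [WeierstrassCurve.Ψ₂Sq, eval_add, eval_mul, eval_C, eval_pow, eval_X]
    linear_combination fourXCubed_add_eq_zero_of_twoTorsion hEq h2y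
  obtain ⟨W', k, hW'ell, hW'min, hiso, hk2, hk0, hc4, hc6, hval⟩ :=
    ManinLocalTwoThree.exists_isIsogenous_dvd_two_velu_two W₀ q' hq'Ψ
  haveI := hW'ell
  haveI := hW'min
  haveI : (W'.baseChange ℂ).IsElliptic := by rw [WeierstrassCurve.baseChange]; infer_instance
  obtain ⟨L', hL'⟩ := exists_isNeronLatticeOf_holds (W'.baseChange ℂ)
  have hgood' : W'.HasGoodReductionAtPrime 2 := (hiso.hasGoodReductionAtPrime_iff 2).mp hgood
  -- `k = ±1` from the valuation law at `2` (étale case: `β ∈ ℤ`)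
  have hB_eq : 3 * q' ^ 2 - W₀.c₄ / 48 = (βz : ℚ) / 2 := by
    rw [hq', WeierstrassCurve.c₄, ← hβcast]; simp only [WeierstrassCurve.b₂, WeierstrassCurve.b₄]; ring
  have hk_sq : k = 1 ∨ k = -1 := by
    have hv := hval 2
    have hv0 : padicValInt 2 W₀.minimalDiscriminantInt = 0 :=
      padicValInt.eq_zero_of_not_dvd (not_dvd_minimalDiscriminantInt_of_hasGoodReductionAtPrime' W₀ 2 hgood)
    have hv0' : padicValInt 2 W'.minimalDiscriminantInt = 0 :=
      padicValInt.eq_zero_of_not_dvd (not_dvd_minimalDiscriminantInt_of_hasGoodReductionAtPrime' W' 2 hgood')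
    have hvB : padicValRat 2 (3 * q' ^ 2 - W₀.c₄ / 48) = (padicValInt 2 βz : ℤ) - 1 := by
      rw [hB_eq, padicValRat.div hβz0 (by norm_num), padicValRat.of_int]
      have : padicValRat 2 (2 : ℚ) = 1 := by
        rw [show (2 : ℚ) = ((2 : ℕ) : ℚ) by norm_num, padicValRat.of_nat]; simp
      rw [this]
    rw [hv0, hv0', hvB] at hv
    have hvk : padicValInt 2 k = 0 := by
      have h1 : (3 : ℤ) * (padicValInt 2 βz : ℤ) + 12 * (padicValInt 2 k : ℤ) = 3 := by push_cast at hv ⊢; linarith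
      omega
    have hkodd : ¬ (2 : ℤ) ∣ k := by
      intro h2
      have h2' : ((2 : ℕ) : ℤ) ^ 1 ∣ k := by rw [pow_one]; exact_mod_cast h2
      rcases (padicValInt_dvd_iff 1 k).mp h2' with h0 | h1
      · exact hk0 h0
      · omega
    have hkabs : k.natAbs ∣ 2 := by
      have := Int.natAbs_dvd_natAbs.mpr hk2
      simpa using this
    have hk1 : k.natAbs = 1 := by
      rcases (Nat.dvd_prime Nat.prime_two).mp hkabs with h | h
      · exact h
      · exfalso; apply hkodd
        have : (k.natAbs : ℤ) ∣ k := Int.natAbs_dvd.mpr (dvd_refl k)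
        rw [h] at this; exact_mod_cast this
    rcases Int.natAbs_eq_iff.mp (by rw [hk1]; rfl : k.natAbs = (1 : ℤ).natAbs) with h | h
    · exact Or.inl h
    · exact Or.inr h
  have hkQ2 : (k : ℚ) ^ 2 = 1 := by rcases hk_sq with rfl | rfl <;> norm_num
  have hk4 : (k : ℚ) ^ 4 = 1 := by nlinarith [hkQ2]
  have hk6 : (k : ℚ) ^ 6 = 1 := by nlinarith [hkQ2, hk4]
  have hkC : (k : ℂ) ≠ 0 := by exact_mod_cast hk0
  have hkC2 : (k : ℂ) ^ 2 = 1 := by exact_mod_cast hkQ2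
  -- the rescaled Néron lattice `Λ'' = k⁻¹Λ'` has the Vélu invariants
  set L'' : PeriodPair := L'.mulLeft ((k : ℂ)⁻¹) (inv_ne_zero hkC) with hL''def
  have hc₄W' : (W'.baseChange ℂ).c₄ = (W'.c₄ : ℂ) := by simp [WeierstrassCurve.baseChange, WeierstrassCurve.map_c₄]
  have hc₆W' : (W'.baseChange ℂ).c₆ = (W'.c₆ : ℂ) := by simp [WeierstrassCurve.baseChange, WeierstrassCurve.map_c₆]
  have hc₄W₀ : (W₀.baseChange ℂ).c₄ = (W₀.c₄ : ℂ) := by simp [WeierstrassCurve.baseChange, WeierstrassCurve.map_c₄]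
  have he₀ : ℘[L₀] (lam / 2) = ((q' : ℚ) : ℂ) := by
    rw [hq']; push_cast; linear_combination hwp
  set Bc : ℂ := 3 * ℘[L₀] (lam / 2) ^ 2 - L₀.g₂ / 4 with hBc
  have hBcval : Bc = (((3 * q' ^ 2 - W₀.c₄ / 48 : ℚ)) : ℂ) := by
    rw [hBc, he₀, hL₀.1, hc₄W₀]; push_cast; ring
  have hBc0 : Bc ≠ 0 := by
    rw [hBcval]; exact_mod_cast ManinLocalTwoThree.velu_two_B_ne_zero W₀ q' hq'Ψ
  have hc4' : W'.c₄ = 720 * q' ^ 2 - 4 * W₀.c₄ := by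
    rw [← one_mul W'.c₄, ← hk4]; linear_combination hc4
  have hc6' : W'.c₆ = 19008 * q' ^ 3 - 144 * W₀.c₄ * q' := by
    rw [← one_mul W'.c₆, ← hk6]; linear_combination hc6
  have hk4C : ((k : ℂ)) ^ 4 = 1 := by exact_mod_cast hk4
  have hk6C : ((k : ℂ)) ^ 6 = 1 := by exact_mod_cast hk6
  have h₂ : L''.g₂ = 12 * ℘[L₀] (lam / 2) ^ 2 + 16 * Bc := by
    rw [hL''def, PeriodPair.g₂_mulLeft, hL'.1, hc₄W', hc4', hBcval, he₀, inv_pow, inv_inv, hk4C]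
    push_cast; ring
  have h₃ : L''.g₃ = -8 * ℘[L₀] (lam / 2) ^ 3 + 32 * Bc * ℘[L₀] (lam / 2) := by
    rw [hL''def, PeriodPair.g₃_mulLeft, hL'.2, hc₆W', hc6', hBcval, he₀, inv_pow, inv_inv, hk6C]
    push_cast; ring
  have hz₀ : lam / 2 ∉ L₀.lattice := hlam2
  have h2z₀ : 2 * (lam / 2) ∈ L₀.lattice := by
    have e : 2 * (lam / 2) = lam := by ring
    rw [e]; exact hlam
  obtain ⟨hle, hz₀mem, hidx⟩ := L₀.lattice_eq_of_velu_invariants hz₀ h2z₀ hBc hBc0 L'' h₂ h₃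
  -- `Λ'' = Λ'` as sets (`k = ±1`)
  have hmem'' : ∀ y : ℂ, y ∈ L''.lattice ↔ (k : ℂ) * y ∈ L'.lattice := by
    intro y; rw [hL''def, PeriodPair.mem_mulLeft_lattice, inv_inv]
  have hLL : ∀ y : ℂ, y ∈ L''.lattice ↔ y ∈ L'.lattice := by
    intro y
    rw [hmem'']
    rcases hk_sq with hk | hk
    · have : (k : ℂ) = 1 := by exact_mod_cast hk
      rw [this, one_mul]
    · have : (k : ℂ) = -1 := by exact_mod_cast hk
      rw [this, neg_one_mul]
      exact ⟨fun h ↦ by simpa using neg_mem h, fun h ↦ neg_mem h⟩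
  -- the datum for (F): `c = q/2 ∈ ℤ` (HERE the evenness of `q` is used), `cΛ₁(f) ⊆ Λ'`, and the cusp image `μ/2 ∉ Λ'`
  obtain ⟨c, hc⟩ := hev
  have hqc : (q : ℂ) = 2 * (c : ℂ) := by rw [hc]; push_cast; ring
  have hc0 : c ≠ 0 := by rintro rfl; simp at hc; exact hq0 hc
  have hcΛ₁ : ∀ z ∈ periodLatticeGamma1 f, (c : ℂ) * z ∈ L'.lattice := by
    intro z hz
    obtain ⟨k₁, w, hw, e⟩ := hparΛ₁ z hz
    have e' : (c : ℂ) * z = (k₁ : ℂ) * (lam / 2) + w := by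
      have : (2 : ℂ) * ((c : ℂ) * z) = 2 * ((k₁ : ℂ) * (lam / 2) + w) := by rw [← mul_assoc, ← hqc, e]; ring
      exact mul_left_cancel₀ two_ne_zero this
    rw [e', ← hLL]
    exact add_mem (by rw [← zsmul_eq_mul]; exact Submodule.smul_of_tower_mem _ k₁ hz₀mem) (hle hw)
  have hcs : (c : ℂ) * cuspSymbol f ⟨γ, hγ⟩ = μ / 2 := by
    rw [hμdef, hqc]; ring
  have hμ2L' : (c : ℂ) * cuspSymbol f ⟨γ, hγ⟩ ∉ L'.lattice := by
    rw [hcs, ← hLL]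
    intro h
    rcases hidx _ h with h1 | h1
    · exact hμ2 h1
    · exact hμz h1
  -- ### (3) apply (F) to `(W′, f, Λ′, c = q/2, γ)`
  have hW'f : IsNewformOf W' f := hW₀.of_isIsogenous hiso.symm_of_charZero
  obtain ⟨x', y', hns', hx', hy', hred⟩ := hF W' f hW'f L' hL' c hc0 hcΛ₁ γ hγ hμ2L'
  rw [hcs] at hx' hy'
  -- `T̄ = (x′, y′)` is a 2-torsion point with `x′ = −2e₀ − b₂(W′)/12`
  have h2half : 2 * (μ / 2) ∈ L'.lattice := by
    rw [show 2 * (μ / 2) = μ by ring, ← hLL]; exact hle hμL₀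
  have hd0 : ℘'[L'] (μ / 2) = 0 := L'.derivWeierstrassP_eq_zero_of_two_mul_mem h2half
  have h2y' : 2 * y' + W'.a₁ * x' + W'.a₃ = 0 := by
    have h : ((2 * y' + W'.a₁ * x' + W'.a₃ : ℚ) : ℂ) = 0 := by
      push_cast; rw [hy', hd0]; ring
    exact_mod_cast h
  have h℘'' : ℘[L''] (μ / 2) = -2 * ℘[L₀] (lam / 2) :=
    weierstrassP_velu_otherHalfPeriod L₀ L'' hz₀ h2z₀ hBc hBc0 h₂ h₃ hμL₀ hμ2 hμz
  have h℘L' : ℘[L'] (μ / 2) = -2 * (((q' : ℚ)) : ℂ) := by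
    have hsc := PeriodPair.weierstrassP_mulLeft ((k : ℂ)⁻¹) (inv_ne_zero hkC) L' (μ / 2)
    rw [← hL''def] at hsc
    have hkμ : ℘[L''] ((k : ℂ)⁻¹ * (μ / 2)) = ℘[L''] (μ / 2) := by
      rcases hk_sq with hk | hk
      · have hk' : (k : ℂ) = 1 := by exact_mod_cast hk
        rw [hk', inv_one, one_mul]
      · have hk' : (k : ℂ) = -1 := by exact_mod_cast hk
        rw [hk', show (-1 : ℂ)⁻¹ * (μ / 2) = -(μ / 2) by ring, L''.weierstrassP_neg]
    rw [hkμ, h℘'', he₀, inv_pow, inv_inv, hkC2] at hsc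
    linear_combination (-1 : ℂ) * hsc
  have hx'val : x' = -2 * q' - W'.b₂ / 12 := by
    have h : ((x' : ℚ) : ℂ) = ((-2 * q' - W'.b₂ / 12 : ℚ) : ℂ) := by
      rw [hx', h℘L']; push_cast; ring
    exact_mod_cast h
  -- `Φ_x(T̄) = −D/16`
  have hΦ : W'.a₁ * y' - (3 * x' ^ 2 + 2 * W'.a₂ * x' + W'.a₄) = -D / 16 := by
    have hc4'' : ((W'.a₁ ^ 2 + 4 * W'.a₂) ^ 2 - 24 * (2 * W'.a₄ + W'.a₁ * W'.a₃)) =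
        720 * q' ^ 2 - 4 * (W₀.b₂ ^ 2 - 24 * W₀.b₄) := by
      have h := hc4'
      simp only [WeierstrassCurve.c₄, WeierstrassCurve.b₂, WeierstrassCurve.b₄] at h ⊢
      linear_combination h
    have hb₂' : W'.b₂ = W'.a₁ ^ 2 + 4 * W'.a₂ := rfl
    rw [hD, hx'val, hb₂', hq']
    rw [hx'val, hb₂', hq'] at h2y'
    rw [hq'] at hc4''
    linear_combination (W'.a₁ / 2) * h2y' + (1 / 48) * hc4''
  -- `4x′ ∈ ℤ`, so `ord_p x′ ≥ 0` at every odd prime `p`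
  have hEq' : W'.toAffine.Equation x' y' := hns'.1
  have hx'int : ∀ p : ℕ, p.Prime → p ≠ 2 → 0 ≤ padicValRat p x' := by
    intro p hp hp2
    haveI : Fact p.Prime := ⟨hp⟩
    have hcub := PrimeConductorTwoTorsion.cubic_eq_zero W' hEq' h2y'
    have hb₂' : W'.b₂ = ((WeierstrassCurve.integralModelInt W').b₂ : ℚ) := by
      conv_lhs => rw [← WeierstrassCurve.map_integralModelInt W']
      rw [WeierstrassCurve.map_b₂, eq_intCast]
    have hb₄' : W'.b₄ = ((WeierstrassCurve.integralModelInt W').b₄ : ℚ) := by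
      conv_lhs => rw [← WeierstrassCurve.map_integralModelInt W']
      rw [WeierstrassCurve.map_b₄, eq_intCast]
    have hb₆' : W'.b₆ = ((WeierstrassCurve.integralModelInt W').b₆ : ℚ) := by
      conv_lhs => rw [← WeierstrassCurve.map_integralModelInt W']
      rw [WeierstrassCurve.map_b₆, eq_intCast]
    rw [hb₂', hb₄', hb₆'] at hcub
    obtain ⟨ζ, hζ⟩ := PrimeConductorTwoTorsion.exists_int_eq_of_cubic (WeierstrassCurve.integralModelInt W') hcub
    have hx'ζ : x' = (ζ : ℚ) / 4 := by rw [hζ]; ring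
    by_cases hζ0 : ζ = 0
    · rw [hx'ζ, hζ0]; simp
    · rw [hx'ζ, padicValRat.div (by exact_mod_cast hζ0) (by norm_num), padicValRat.of_int]
      have h4 : padicValRat p (4 : ℚ) = 0 := by
        rw [show (4 : ℚ) = ((4 : ℕ) : ℚ) by norm_num, padicValRat.of_nat]
        have : padicValNat p 4 = 0 := by
          apply padicValNat.eq_zero_of_not_dvd
          intro h
          have : p ∣ 2 ^ 2 := by simpa using h
          have := (Nat.prime_dvd_prime_iff_eq hp Nat.prime_two).mp (hp.dvd_of_dvd_pow this)
          exact hp2 this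
        exact_mod_cast this
      rw [h4, sub_zero]
      exact_mod_cast Nat.zero_le _
  -- ### (4) read (F) at every odd prime: `D` has no odd prime factor
  have hDz0 : Dz ≠ 0 := by
    rintro h0
    have : (4 : ℤ) * M.Δ = 0 := by rw [← hrel, h0]; ring
    rcases hΔodd with ⟨m, hm⟩
    omega
  have hodd : ∀ p : ℕ, p.Prime → p ≠ 2 → ¬ (p : ℤ) ∣ Dz := by
    intro p hp hp2 hpD
    haveI : Fact p.Prime := ⟨hp⟩
    have hredp := hred p hp
    unfold WeierstrassCurve.HasNonsingularReductionAt at hredp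
    rw [WeierstrassCurve.Affine.evalEval_polynomialX, WeierstrassCurve.Affine.evalEval_polynomialY] at hredp
    rcases hredp with hneg | ⟨-, hΦunit⟩ | ⟨hY0, -⟩
    · exact absurd hneg (not_lt.mpr (hx'int p hp hp2))
    · rw [hΦ, hDcast] at hΦunit
      rw [neg_div, padicValRat.neg, padicValRat.div (by exact_mod_cast hDz0) (by norm_num), padicValRat.of_int] at hΦunit
      have h16 : padicValRat p (16 : ℚ) = 0 := by
        rw [show (16 : ℚ) = ((16 : ℕ) : ℚ) by norm_num, padicValRat.of_nat]
        have : padicValNat p 16 = 0 := by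
          apply padicValNat.eq_zero_of_not_dvd
          intro h
          have : p ∣ 2 ^ 4 := by simpa using h
          have := (Nat.prime_dvd_prime_iff_eq hp Nat.prime_two).mp (hp.dvd_of_dvd_pow this)
          exact hp2 this
        exact_mod_cast this
      rw [h16, sub_zero] at hΦunit
      have hv : padicValInt p Dz = 0 := by exact_mod_cast hΦunit
      rcases (padicValInt_dvd_iff 1 Dz).mp (by simpa using hpD) with h0 | h1
      · exact hDz0 h0
      · rw [hv] at h1; exact absurd h1 (by norm_num)
    · exact absurd h2y' hY0
  -- `D` is odd: `4Δ = β²D`, `Δ` odd, `ord₂ β = 1`  ⟹  `D = 1`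
  have hDodd : ¬ (2 : ℤ) ∣ Dz := by
    intro h2
    -- `ord₂ β = 1` from the valuation law at `2`
    have hv := hval 2
    have hv0 : padicValInt 2 W₀.minimalDiscriminantInt = 0 :=
      padicValInt.eq_zero_of_not_dvd (not_dvd_minimalDiscriminantInt_of_hasGoodReductionAtPrime' W₀ 2 hgood)
    have hv0' : padicValInt 2 W'.minimalDiscriminantInt = 0 :=
      padicValInt.eq_zero_of_not_dvd (not_dvd_minimalDiscriminantInt_of_hasGoodReductionAtPrime' W' 2 hgood')
    have hvB : padicValRat 2 (3 * q' ^ 2 - W₀.c₄ / 48) = (padicValInt 2 βz : ℤ) - 1 := by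
      rw [hB_eq, padicValRat.div hβz0 (by norm_num), padicValRat.of_int]
      have : padicValRat 2 (2 : ℚ) = 1 := by
        rw [show (2 : ℚ) = ((2 : ℕ) : ℚ) by norm_num, padicValRat.of_nat]; simp
      rw [this]
    have hvk : padicValInt 2 k = 0 := by
      rcases hk_sq with hk | hk <;> simp [hk, padicValInt]
    rw [hv0, hv0', hvB, hvk] at hv
    have hvβ : padicValInt 2 βz = 1 := by
      have h1 : (3 : ℤ) * (padicValInt 2 βz : ℤ) = 3 := by push_cast at hv ⊢; linarith
      omega
    have h2β : (2 : ℤ) ∣ βz := by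
      have h := (padicValInt_dvd_iff 1 βz).mpr (Or.inr (by rw [hvβ]))
      simpa using h
    obtain ⟨β', hβ'⟩ := h2β
    obtain ⟨d, hd⟩ := h2
    have hΔeq : M.Δ = β' ^ 2 * Dz := by
      have h4 : (4 : ℤ) * M.Δ = 4 * (β' ^ 2 * Dz) := by rw [← hrel, hβ']; ring
      exact mul_left_cancel₀ (by norm_num) h4
    have heven : Even M.Δ := ⟨β' ^ 2 * d, by rw [hΔeq, hd]; ring⟩
    exact (Int.not_even_iff_odd.mpr hΔodd) heven
  have hD1 : Dz = 1 := by
    -- no prime divides `Dz`, so `|Dz| = 1`; and `Dz = α² − 32β ≠ −1`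
    have habs : Dz.natAbs = 1 := by
      by_contra hne1
      obtain ⟨p, hp, hpd⟩ := Nat.exists_prime_and_dvd hne1
      have hpD : (p : ℤ) ∣ Dz := Int.ofNat_dvd_left.mpr hpd
      by_cases hp2 : p = 2
      · subst hp2; exact hDodd (by exact_mod_cast hpD)
      · exact hodd p hp hp2 hpD
    rcases Int.natAbs_eq_iff.mp (by rw [habs]; rfl : Dz.natAbs = (1 : ℤ).natAbs) with h | h
    · exact h
    · exact absurd h (by rw [hDz]; exact sq_ne_thirtytwo_mul_sub_one αz βz)
  have hD1' : αz ^ 2 - 32 * βz = 1 := by rw [← hDz]; exact hD1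
  -- ### (5) the second étale root
  exact exists_second_etale_root W₀ hξ hαcast hβcast hβ0 hx hD1'

end Summit.BirchSwinnertonDyer.BirchSwinnertonDyer.Theorems.DepletionAtTwo.SigmaNode

end
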